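import Literature.Computability.Cryptography.HallgrenClassGroupQuantumKernel
import Literature.Computability.Cryptography.HallgrenClassGroupReduceFP
import Literature.Computability.Complexity.CodeFPStrings
import HarnessLib

/-!
# Hallgren 2005 / class numbers under GRH — the clean block of Kitaev's class-group experiment as
# a polynomial-time function (the trial forms from the controls)

Topic `Literature/Computability/Cryptography`; proof companion of `HallgrenClassGroupAssembly.lean`
(named fact `Hallgren2005.subgroupOrder_qsolvable`, Kitaev 1995, §4). Definitions and theorems;
no named fact. The class-group twin of `ShorDiscreteLogBlock.lean` (§§ block function): the content
of the data wires of Kitaev's circuit `kitaevClFamily` — the instance `w = encodeClInstance d L`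
(`|w| = ℓ`) followed by the `clNumControls ℓ` control bits `c` — is mapped to the coded list of the
`clTrials ℓ` TRIAL FORMS `reduce (∏_i slotForm_i ^ E_{t,i}(c))` (`HallgrenClassGroupQuantumKernel.trialForm`;
Kitaev 1995, §4 p. 15: the permutations `V_j^{2^s}` of the `l` shared registers; Childs–van Dam 2010,
§5.7: the group law is composition and reduction of forms). Written in the typed polynomial-time
algebra `CodeFP` (Arora–Barak 2009, §1.3) above the bricks `composeGC`/`reduceGC` of
`HallgrenClassGroupReduceFP.lean`:

* the layout arithmetic `clTrialsC`, …, `dataLenC`, and the instance length from the total length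
  (`lenOf`, `lenOf_eq`, `lenOfC`);
* decoders `decodeForm` (`decodeForm_formCode`), the principal form `oneC`;
* the CLAMPED composition `compC` (the guarded composition `composeG`, replaced by the principal form
  whenever a coefficient exceeds `|D| + 1` — never on the genuine run, `compC_eq_compose` — so that
  every fold accumulator is honestly short, `length_formE_compC_le`), powers by the binary method
  `powG` (`classOf'_powG`), the exponents `ctrlExpL` (window counts, Horner), the trial forms
  `trialFormL` and the typed core `coreC`;
* the untyped outer layer `parseF` and **`clBlockFn`**, **`clBlockFn_mem_FP`**,
  **`clBlockFn_wellFormed`**.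

## References

* A. Yu. Kitaev, *Quantum measurements and the Abelian Stabilizer Problem*, arXiv:quant-ph/9511026
  (1995), §4 p. 15 [Kitaev1995].
* A. M. Childs, W. van Dam, Rev. Mod. Phys. 82 (2010), §5.7 [ChildsVandam2010].
* D. A. Cox, *Primes of the form x² + ny²*, 2nd ed. (2013), §2.A, §3.A [Cox2013].
* S. Arora, B. Barak, *Computational Complexity: A Modern Approach*, CUP 2009, §1.3 [AroraBarak2009].
-/

noncomputable section

namespace Literature.Computability.Cryptography.Hallgren2005

namespace ClBlockFP

open _root_.Computability Literature.Computability.Complexity Literature.Computability.Complexity.CodeFP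
  Literature.Computability.Complexity.Brick Polynomial
open Literature.NumberTheory.QuadraticFields.Quadratic (BinQF)
open Literature.NumberTheory.QuadraticFields.Quadratic.BinQF (IsPosPrim)
open Literature.NumberTheory.QuadraticFields.BinaryQuadraticForm (principalForm)
open FormComposition Reduction OrderCl ClFP

/-! ### The layout parameters on codes -/

/-- `clTrials` on codes. [folklore] -/
theorem clTrialsC : CodeFP natE natE clTrials := by
  have hid := CodeFP.id natE
  have h := natAdd.comp ((natMul.comp ((const natE (4 : ℕ)).pair (natMul.comp (hid.pair hid)))).pair (const natE (4 : ℕ)))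
  exact h.congr fun n => by simp [clTrials, sq]

/-- `clLevels` on codes. [folklore] -/
theorem clLevelsC : CodeFP natE natE clLevels := by
  have h := natAdd.comp ((natMul.comp ((const natE (4 : ℕ)).pair (CodeFP.id natE))).pair (const natE (1 : ℕ)))
  exact h.congr fun n => by simp [clLevels]

/-- `clNumBlocks` on codes. [folklore] -/
theorem clNumBlocksC : CodeFP natE natE clNumBlocks := by
  have hid := CodeFP.id natE
  have h := natMul.comp (clTrialsC.pair (natMul.comp (hid.pair (natMul.comp (clLevelsC.pair (const natE (2 : ℕ)))))))
  exact h.congr fun n => by simp [clNumBlocks, clSlots]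

/-- `clBlockSize` on codes. [folklore] -/
theorem clBlockSizeC : CodeFP natE natE clBlockSize := by
  have h := natMul.comp ((const natE (768 : ℕ)).pair (natAdd.comp (clNumBlocksC.pair (const natE (1 : ℕ)))))
  exact h.congr fun n => by simp [clBlockSize]

/-- `clNumControls` on codes. [folklore] -/
theorem clNumControlsC : CodeFP natE natE clNumControls := by
  have hid := CodeFP.id natE
  have h := natMul.comp (clTrialsC.pair (natMul.comp (hid.pair (natMul.comp (clLevelsC.pair
    (natMul.comp ((const natE (2 : ℕ)).pair clBlockSizeC)))))))
  exact h.congr fun n => by simp [clNumControls, clSlots]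

/-- The data length `ℓ + clNumControls ℓ` on codes. [folklore] -/
theorem dataLenC : CodeFP natE natE (fun ℓ => ℓ + clNumControls ℓ) := natAdd.comp ((CodeFP.id natE).pair clNumControlsC)

/-- The data length is increasing in `ℓ`. [folklore] -/
theorem dataLen_strictMono : StrictMono fun ℓ => ℓ + clNumControls ℓ := by
  refine strictMono_nat_of_lt_succ fun ℓ => ?_
  have : clNumControls ℓ ≤ clNumControls (ℓ + 1) := by
    unfold clNumControls clBlockSize clNumBlocks clTrials clSlots clLevels
    gcongr <;> omega
  show ℓ + clNumControls ℓ < ℓ + 1 + clNumControls (ℓ + 1)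
  omega

/-! ### The instance length from the total length -/

/-- **The instance length of a data string of length `n`**: the (unique) `j ≤ n` with
`j + clNumControls j = n`, else `0`. [folklore] -/
def lenOf (n : ℕ) : ℕ := ((List.range (n + 1)).filter fun j => decide (j + clNumControls j = n)).headD 0

/-- The filter behind `lenOf` on a genuine data length. [folklore] -/
theorem filter_range_dataLen (ℓ : ℕ) : ∀ m : ℕ,
    (List.range m).filter (fun j => decide (j + clNumControls j = ℓ + clNumControls ℓ)) = if ℓ < m then [ℓ] else []
  | 0 => by simp
  | m + 1 => by
    rw [List.range_succ, List.filter_append, filter_range_dataLen ℓ m, List.filter_singleton]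
    have hinj : ∀ j, (j + clNumControls j = ℓ + clNumControls ℓ) ↔ j = ℓ := fun j =>
      ⟨fun h => dataLen_strictMono.injective h, fun h => by rw [h]⟩
    by_cases h1 : ℓ < m
    · rw [if_pos h1, if_pos (by omega), decide_eq_false (by rw [hinj]; omega)]; simp
    · rw [if_neg h1]
      by_cases h2 : m = ℓ
      · subst h2; rw [decide_eq_true rfl, if_pos (by omega)]; simp
      · rw [decide_eq_false (by rw [hinj]; exact h2), if_neg (by omega)]; simp

/-- **`lenOf` finds the instance length.** [folklore] -/
theorem lenOf_eq (ℓ : ℕ) : lenOf (ℓ + clNumControls ℓ) = ℓ := by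
  rw [lenOf, filter_range_dataLen, if_pos (by omega)]; rfl

/-- `lenOf n ≤ n`. [folklore] -/
theorem lenOf_le (n : ℕ) : lenOf n ≤ n := by
  rw [lenOf]
  set l := (List.range (n + 1)).filter fun j => decide (j + clNumControls j = n) with hl
  cases hl' : l with
  | nil => simp
  | cons a t =>
    have ha : a ∈ l := by rw [hl']; simp
    have := List.mem_range.1 (List.mem_of_mem_filter ha)
    simp only [List.headD_cons]; omega

/-- `lenOf` on codes (unary in, unary out). [cite: AroraBarak2009, §1.3] -/
theorem lenOfC : CodeFP unE unE lenOf := by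
  have hp : CodeFP (pairE unE natE) bitE (fun t => decide (t.2 + clNumControls t.2 = t.1)) :=
    natEq.comp ((dataLenC.comp (snd unE natE)).pair (natOfUn.comp (fst unE natE)))
  have hf := filter hp
  have hr : CodeFP unE (rawE natE) (fun n => List.range (n + 1)) := urange.comp unSucc
  have hb : CodeFP unE natE lenOf :=
    ((rawHeadD natE natE_zero).comp (hf.comp ((CodeFP.id unE).pair hr))).congr fun n => rfl
  exact (unOfNatMin.comp ((CodeFP.id unE).pair hb)).congr fun n => by simp [min_eq_left (lenOf_le n)]

/-! ### Decoding the instance -/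

/-- `fstF` as a typed map on strings. [folklore] -/
theorem fstFC : CodeFP strE strE fstF := of_fn fstF fstF_mem_FP fun _ => rfl

/-- `sndF` as a typed map on strings. [folklore] -/
theorem sndFC : CodeFP strE strE sndF := of_fn sndF sndF_mem_FP fun _ => rfl

/-- The integer of a difference-pair string. [folklore] -/
def intOfStr (s : List Bool) : ℤ := (bitsToNat (fstF s) : ℤ) - bitsToNat (sndF s)

/-- `intOfStr` decodes `dpEnc`. [folklore] -/
theorem intOfStr_dpEnc (z : ℤ) : intOfStr (dpEnc z) = z := by
  unfold intOfStr dpEnc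
  rw [fstF_boolPair, sndF_boolPair, bitsToNat_encodeNat, bitsToNat_encodeNat]
  omega

/-- `intOfStr` on codes. [folklore] -/
theorem intOfStrC : CodeFP strE intE intOfStr :=
  (intSub.comp ((intOfNat.comp (strVal.comp fstFC)).pair (intOfNat.comp (strVal.comp sndFC)))).congr fun _ => rfl

/-- **The form of a form code** `⟨bin a, ⟨dp b, bin c⟩⟩` (total). [folklore] -/
def decodeForm (s : List Bool) : BinQF := ⟨bitsToNat (fstF s), intOfStr (fstF (sndF s)), bitsToNat (sndF (sndF s))⟩

/-- `decodeForm` decodes `formCode`. [folklore] -/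
theorem decodeForm_formCode (q : ℕ × ℤ × ℕ) : decodeForm (formCode q) = toForm q := by
  obtain ⟨a, b, c⟩ := q
  simp only [decodeForm, formCode, toForm, fstF_boolPair, sndF_boolPair, bitsToNat_encodeNat, intOfStr_dpEnc]

/-- `decodeForm` on codes. [folklore] -/
theorem decodeFormC : CodeFP strE formE decodeForm :=
  (mkFormC.comp ((intOfNat.comp (strVal.comp fstFC)).pair ((intOfStrC.comp (fstFC.comp sndFC)).pair
    (intOfNat.comp (strVal.comp (sndFC.comp sndFC)))))).congr fun _ => rfl

/-! ### The principal form and the clamped composition -/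

/-- `one D` in closed form. [folklore] -/
theorem one_eq (D : ℤ) : one D = if D % 4 = 0 then ⟨1, 0, -D / 4⟩ else ⟨1, 1, (1 - D) / 4⟩ := by
  unfold one principalForm
  split_ifs <;> rfl

/-- The principal form on codes. [folklore] -/
theorem oneC : CodeFP intE formE one := by
  have hid := CodeFP.id intE
  have c0 : CodeFP intE intE (fun _ => (0 : ℤ)) := const intE (0 : ℤ)
  have c1 : CodeFP intE intE (fun _ => (1 : ℤ)) := const intE (1 : ℤ)
  have c4 : CodeFP intE intE (fun _ => (4 : ℤ)) := const intE (4 : ℤ)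
  have hq := intEDiv.comp (hid.pair c4)
  have hmod : CodeFP intE intE (fun D => D % 4) := (intSub.comp (hid.pair (intMul.comp (c4.pair hq)))).congr fun D => by
    simp only [id]; rw [Int.emod_def]
  have htest := intEq.comp (hmod.pair c0)
  have hA := mkFormC.comp (c1.pair (c0.pair (intEDiv.comp ((intNeg.comp hid).pair c4))))
  have hB := mkFormC.comp (c1.pair (c1.pair (intEDiv.comp ((intSub.comp (c1.pair hid)).pair c4))))
  refine (ite htest hA hB).congr fun D => ?_
  rw [one_eq]
  by_cases h : D % 4 = 0 <;> simp [h]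

/-- A form is `D`-small: all coefficients are at most `|D| + 1` in absolute value. [folklore] -/
def Small (D : ℤ) (f : BinQF) : Prop := |f.a| ≤ |D| + 1 ∧ |f.b| ≤ |D| + 1 ∧ |f.c| ≤ |D| + 1

/-- Smallness is decidable. [folklore] -/
instance (D : ℤ) (f : BinQF) : Decidable (Small D f) := inferInstanceAs (Decidable (_ ∧ _ ∧ _))

/-- The principal form is small. [folklore] -/
theorem small_one (D : ℤ) : Small D (one D) := by
  rw [one_eq]
  have h4 : (0 : ℤ) ≤ |D| := abs_nonneg D
  have hD : -|D| ≤ D ∧ D ≤ |D| := abs_le.1 le_rfl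
  split_ifs with h
  · show |(1 : ℤ)| ≤ |D| + 1 ∧ |(0 : ℤ)| ≤ |D| + 1 ∧ |-D / 4| ≤ |D| + 1
    refine ⟨?_, ?_, ?_⟩ <;> rw [abs_le] <;> constructor <;> omega
  · show |(1 : ℤ)| ≤ |D| + 1 ∧ |(1 : ℤ)| ≤ |D| + 1 ∧ |(1 - D) / 4| ≤ |D| + 1
    refine ⟨?_, ?_, ?_⟩ <;> rw [abs_le] <;> constructor <;> omega

/-- A reduced positive definite form of discriminant `D` is small. [cite: Cox2013, §2.A (2.12)] -/
theorem small_of_isReduced {D : ℤ} {f : BinQF} (hp : posDef D f) (hr : f.IsReduced) : Small D f := by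
  obtain ⟨h1, h2, h3⟩ := coeffs_le_of_isReduced hp hr
  exact ⟨by omega, by omega, by omega⟩

/-- Small forms have short codes. [folklore] -/
theorem length_formE_le_of_small {D : ℤ} {f : BinQF} (h : Small D f) : (formE f).length ≤ 15 * Nat.size (|D| + 1).toNat + 14 :=
  length_formE_le_of_bounds h.1 h.2.1 h.2.2

/-- `size (|D| + 1) ≤ |intE D| + 1`. [folklore] -/
theorem size_abs_succ_le (D : ℤ) : Nat.size (|D| + 1).toNat ≤ (intE D).length + 1 := by
  refine size_toNat_le_of_lt (by positivity) ?_
  have := abs_lt_two_pow_length_intE D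
  have h0 : (0 : ℤ) < 2 ^ (intE D).length := by positivity
  rw [pow_succ]; omega

/-- **The clamped composition**: the guarded composition, replaced by the principal form when it
is not small (never on the genuine run). [folklore] -/
def compC (D : ℤ) (f g : BinQF) : BinQF := if Small D (composeG D f g) then composeG D f g else one D

/-- The clamped composition is small. [folklore] -/
theorem small_compC (D : ℤ) (f g : BinQF) : Small D (compC D f g) := by
  unfold compC; split_ifs with h
  · exact h
  · exact small_one D

/-- **On valid inputs the clamped composition is `compose`.** [cite: Cox2013, §3.A] -/
theorem compC_eq_compose {D : ℤ} {f g : BinQF} (hD : D < 0) (hf : f.IsPosPrim D) (hg : g.IsPosPrim D) :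
    compC D f g = compose D f g := by
  have h := composeG_eq_compose hD hf hg
  have h1 := isPosPrim_compose' ⟨D, hD⟩ hf hg
  have h2 := isReduced_compose' ⟨D, hD⟩ hf hg
  rw [compC, h, if_pos (small_of_isReduced ⟨h1.a_pos, h1.disc_eq, hD⟩ h2)]

/-- `decide (Small D f)` on codes. [folklore] -/
theorem smallC : CodeFP (pairE intE formE) bitE (fun p => decide (Small p.1 p.2)) := by
  have hD : CodeFP (pairE intE formE) intE (fun p => p.1) := fst intE formE
  have hf : CodeFP (pairE intE formE) formE (fun p => p.2) := snd intE formE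
  have hB := intAdd.comp ((intAbs.comp hD).pair (const _ (1 : ℤ)))
  have h1 := intLe.comp ((intAbs.comp (aC.comp hf)).pair hB)
  have h2 := intLe.comp ((intAbs.comp (bC.comp hf)).pair hB)
  have h3 := intLe.comp ((intAbs.comp (cC.comp hf)).pair hB)
  refine (h1.and (h2.and h3)).congr fun p => ?_
  simp only [Small, Bool.decide_and]

/-- `compC` on codes. [cite: AroraBarak2009, §1.3] -/
theorem compCC : CodeFP (pairE intE (pairE formE formE)) formE (fun p => compC p.1 p.2.1 p.2.2) := by
  have hD : CodeFP (pairE intE (pairE formE formE)) intE (fun p => p.1) := fst intE (pairE formE formE)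
  have hs := smallC.comp (hD.pair composeGC)
  refine (ite hs composeGC (oneC.comp hD)).congr fun p => ?_
  rw [compC]
  by_cases hv : Small p.1 (composeG p.1 p.2.1 p.2.2) <;> simp [hv]

/-! ### Powers by the binary method -/

/-- The bits of `n`, least significant first (the binary numeral itself). [folklore] -/
def bits (n : ℕ) : List Bool := natE n

/-- `bits n` has value `n`. [folklore] -/
theorem bitsToNat_bits (n : ℕ) : bitsToNat (bits n) = n := bitsToNat_encodeNat n

/-- A string as the raw list of its bits (a copy of `ArithFP.strBitsC`, kept local to lighten the
imports). [folklore] -/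
theorem strBitsC' : CodeFP strE (rawE bitE) (fun s => s) := by
  have hitem : CodeFP (pairE strE natE) bitE (fun t => t.1.getD t.2 false) := strGetDNat
  have h := (map hitem).comp ((CodeFP.id strE).pair (urange.comp strLength))
  refine h.congr fun s => ?_
  simp only [id]
  refine List.ext_getElem (by simp) fun i h1 h2 => ?_
  rw [List.getElem_map, List.getElem_range, List.getD_eq_getElem?_getD, List.getElem?_eq_getElem (by simpa using h2), Option.getD_some]

/-- `bits` on codes. [folklore] -/
theorem bitsC : CodeFP natE (rawE bitE) bits := (strBitsC'.comp strOfNat).congr fun _ => rfl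

/-- One step of the binary method on `(accumulator, running square)`. [cite: AroraBarak2009, §1.3] -/
def powStep (D : ℤ) (st : BinQF × BinQF) (b : Bool) : BinQF × BinQF :=
  (if b then compC D st.1 st.2 else st.1, compC D st.2 st.2)

/-- **`g ^ n` in the form class group by the binary method** (clamped compositions). [cite: Cox2013, §3.A] -/
def powG (D : ℤ) (g : BinQF) (n : ℕ) : BinQF := ((bits n).foldl (powStep D) (one D, g)).1

/-- The state of the binary method stays small (the square is the input or small). [folklore] -/
theorem small_foldl_powStep (D : ℤ) (P₀ : BinQF) : ∀ (l : List Bool) (acc P : BinQF), Small D acc → (Small D P ∨ P = P₀) →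
    Small D (l.foldl (powStep D) (acc, P)).1 ∧ (Small D (l.foldl (powStep D) (acc, P)).2 ∨ (l.foldl (powStep D) (acc, P)).2 = P₀)
  | [], acc, P, ha, hP => ⟨ha, hP⟩
  | b :: l, acc, P, ha, _ => by
    rw [List.foldl_cons]
    refine small_foldl_powStep D P₀ l _ _ ?_ (Or.inl (small_compC D P P))
    show Small D (if b = true then compC D acc P else acc)
    split_ifs
    · exact small_compC D acc P
    · exact ha

section Spec

variable (Δ : NegDiscr)

/-- **The binary method multiplies classes**: from `(acc, P)` the fold over the bits `l` returns a
reduced primitive positive definite form of class `[acc] · [P] ^ (value of l)`. [cite: Cox2013, §3.A] -/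
theorem foldl_powStep_spec : ∀ (l : List Bool) (acc P : BinQF), acc.IsPosPrim Δ.D → acc.IsReduced → P.IsPosPrim Δ.D →
    (l.foldl (powStep Δ.D) (acc, P)).1.IsPosPrim Δ.D ∧ (l.foldl (powStep Δ.D) (acc, P)).1.IsReduced ∧
      classOf' Δ (l.foldl (powStep Δ.D) (acc, P)).1 = classOf' Δ acc * classOf' Δ P ^ bitsToNat l
  | [], acc, P, ha, har, _ => ⟨ha, har, by simp⟩
  | b :: l, acc, P, ha, har, hP => by
    rw [List.foldl_cons, bitsToNat_cons]
    have hPP : compC Δ.D P P = compose Δ.D P P := compC_eq_compose Δ.neg hP hP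
    have hP2 : (compC Δ.D P P).IsPosPrim Δ.D := by rw [hPP]; exact isPosPrim_compose' Δ hP hP
    have hcl2 : classOf' Δ (compC Δ.D P P) = classOf' Δ P ^ 2 := by rw [hPP, classOf'_compose Δ hP hP, sq]
    cases b with
    | false =>
      obtain ⟨h1, h2, h3⟩ := foldl_powStep_spec l acc (compC Δ.D P P) ha har hP2
      refine ⟨h1, h2, ?_⟩
      show classOf' Δ (l.foldl (powStep Δ.D) (powStep Δ.D (acc, P) false)).1 = _
      rw [show powStep Δ.D (acc, P) false = (acc, compC Δ.D P P) from rfl, h3, hcl2, ← pow_mul]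
      simp [Nat.mul_comm 2]
    | true =>
      have hAP : compC Δ.D acc P = compose Δ.D acc P := compC_eq_compose Δ.neg ha hP
      have hA1 : (compC Δ.D acc P).IsPosPrim Δ.D := by rw [hAP]; exact isPosPrim_compose' Δ ha hP
      have hA2 : (compC Δ.D acc P).IsReduced := by rw [hAP]; exact isReduced_compose' Δ ha hP
      obtain ⟨h1, h2, h3⟩ := foldl_powStep_spec l (compC Δ.D acc P) (compC Δ.D P P) hA1 hA2 hP2
      refine ⟨h1, h2, ?_⟩
      show classOf' Δ (l.foldl (powStep Δ.D) (powStep Δ.D (acc, P) true)).1 = _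
      rw [show powStep Δ.D (acc, P) true = (compC Δ.D acc P, compC Δ.D P P) from rfl, h3, hcl2, hAP,
        classOf'_compose Δ ha hP, ← pow_mul]
      simp only [Bool.toNat_true]
      rw [mul_assoc, ← pow_succ', Nat.mul_comm 2, Nat.add_comm]

/-- **`powG` computes powers of classes** as reduced forms. [cite: Cox2013, §3.A, §7.B Thm. 7.7] -/
theorem powG_spec (hD4 : Δ.D % 4 = 0 ∨ Δ.D % 4 = 1) {g : BinQF} (hg : g.IsPosPrim Δ.D) (n : ℕ) :
    (powG Δ.D g n).IsPosPrim Δ.D ∧ (powG Δ.D g n).IsReduced ∧ classOf' Δ (powG Δ.D g n) = classOf' Δ g ^ n := by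
  obtain ⟨h1, h2⟩ := isPosPrim_one Δ.neg hD4
  obtain ⟨g1, g2, g3⟩ := foldl_powStep_spec Δ (bits n) (one Δ.D) g h1 h2 hg
  exact ⟨g1, g2, by rw [powG, g3, classOf'_one Δ hD4, one_mul, bitsToNat_bits]⟩

end Spec

/-- The code of the state of the binary method is short. [folklore] -/
theorem length_powState_le {D : ℤ} {g : BinQF} {st : BinQF × BinQF} (h1 : Small D st.1) (h2 : Small D st.2 ∨ st.2 = g) :
    (pairE formE formE st).length ≤ 45 * (intE D).length + 89 + (formE g).length := by
  have hs := size_abs_succ_le D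
  have ha := length_formE_le_of_small h1
  rw [pairE_apply, length_boolPair]
  rcases h2 with h2 | h2
  · have hb := length_formE_le_of_small h2
    nlinarith
  · rw [h2]; nlinarith

/-- `powStep` on codes (context `(D, g)`, item bit, state). [folklore] -/
theorem powStepC : CodeFP (pairE (pairE intE formE) (pairE bitE (pairE formE formE))) (pairE formE formE)
    (fun t => powStep t.1.1 t.2.2 t.2.1) := by
  have hD : CodeFP (pairE (pairE intE formE) (pairE bitE (pairE formE formE))) intE (fun t => t.1.1) := (fst _ _).fst'
  have hb : CodeFP (pairE (pairE intE formE) (pairE bitE (pairE formE formE))) bitE (fun t => t.2.1) := (snd _ _).fst'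
  have hacc : CodeFP (pairE (pairE intE formE) (pairE bitE (pairE formE formE))) formE (fun t => t.2.2.1) := (snd _ _).snd'.fst'
  have hP : CodeFP (pairE (pairE intE formE) (pairE bitE (pairE formE formE))) formE (fun t => t.2.2.2) := (snd _ _).snd'.snd'
  have h1 := compCC.comp (hD.pair (hacc.pair hP))
  have h2 := compCC.comp (hD.pair (hP.pair hP))
  refine ((ite hb h1 hacc).pair h2).congr fun t => ?_
  rfl

/-- **`powG` on codes.** [cite: AroraBarak2009, §1.3 (polynomially bounded loops)] -/
theorem powGC : CodeFP (pairE intE (pairE formE natE)) formE (fun p => powG p.1 p.2.1 p.2.2) := by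
  have hinit : CodeFP (pairE intE formE) (pairE formE formE) (fun s => (one s.1, s.2)) :=
    (oneC.comp (fst intE formE)).pair (snd intE formE)
  have h := foldl (σ := ℤ × BinQF) (α := Bool) (β := BinQF × BinQF) (eσ := pairE intE formE) (eα := bitE)
    (eβ := pairE formE formE) (step := fun s b st => powStep s.1 st b) (init := fun s => (one s.1, s.2)) powStepC hinit
    (C 45 * X + C 89 + X) (fun s l₁ l₂ => by
      obtain ⟨hs1, hs2⟩ := small_foldl_powStep s.1 s.2 l₁ (one s.1) s.2 (small_one s.1) (Or.inr rfl)
      refine (length_powState_le hs1 hs2).trans ?_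
      simp only [eval_add, eval_mul, eval_C, eval_X, pairE_apply, length_boolPair]
      nlinarith [Nat.zero_le (rawE bitE (l₁ ++ l₂)).length, Nat.zero_le (intE s.1).length])
  have h' := h.comp ((((fst intE (pairE formE natE)).pair (snd intE (pairE formE natE)).fst')).pair
    (bitsC.comp (snd intE (pairE formE natE)).snd'))
  exact h'.fst'.congr fun p => rfl

/-! ### The exponents carried by the controls -/

/-- The number of `1`s in the window of `n` bits at offset `off`. [cite: Kitaev1995, §3 (Lemma 10)] -/
def winCount (c : List Bool) (off n : ℕ) : ℕ := ((c.drop off).take n).count true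

/-- The offset of the controls of trial `t`, slot `i`, level `l` (both test types). [folklore] -/
def clOff (ℓ t i l : ℕ) : ℕ := ((t * clSlots ℓ + i) * clLevels ℓ + l) * (2 * clBlockSize ℓ)

/-- **The exponent of slot `i` in trial `t`**: `∑_l 2^l · #{ones in the level window}`.
[cite: Kitaev1995, §3 Lemma 10 (the powers 2^l), §4 p. 15] -/
def ctrlExpL (ℓ : ℕ) (c : List Bool) (t i : ℕ) : ℕ :=
  ((List.range (clLevels ℓ)).map fun l => 2 ^ l * winCount c (clOff ℓ t i l) (2 * clBlockSize ℓ)).sum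

/-- Counting ones on codes. [folklore] -/
theorem countC : CodeFP strE natE (fun s => s.count true) := of_fn HashBricks.popCountFn HashBricks.popCountFn_mem_FP fun s => by simp

/-- `winCount` on codes. [folklore] -/
theorem winCountC : CodeFP (pairE strE (pairE natE natE)) natE (fun p => winCount p.1 p.2.1 p.2.2) := by
  have hc : CodeFP (pairE strE (pairE natE natE)) strE (fun p => p.1) := fst _ _
  have hoff : CodeFP (pairE strE (pairE natE natE)) natE (fun p => p.2.1) := (snd _ _).fst'
  have hn : CodeFP (pairE strE (pairE natE natE)) natE (fun p => p.2.2) := (snd _ _).snd'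
  have hoffU := unOfNatMin.comp ((strLength.comp hc).pair hoff)
  have hc' := strDrop.comp (hoffU.pair hc)
  have hnU := unOfNatMin.comp ((strLength.comp hc').pair hn)
  have hw := strTake.comp (hnU.pair hc')
  refine (countC.comp hw).congr fun p => ?_
  obtain ⟨c, off, n⟩ := p
  simp only [winCount]
  have hdrop : c.drop (min off c.length) = c.drop off := by
    rcases le_or_gt off c.length with h | h
    · rw [min_eq_left h]
    · rw [min_eq_right h.le, List.drop_eq_nil_of_le le_rfl, List.drop_eq_nil_of_le h.le]
  rw [hdrop, ← List.take_take, List.take_length]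

/-- The arguments of the exponent: `((ℓ, c), (t, i))`. [folklore] -/
abbrev XE : (ℕ × List Bool) × (ℕ × ℕ) → List Bool := pairE (pairE unE strE) (pairE natE natE)

/-- `clLevels` in unary. [folklore] -/
theorem clLevelsU : CodeFP unE unE clLevels := (unSucc.comp (unMulConst 4)).congr fun n => by simp [clLevels]

/-- `clTrials` in unary. [folklore] -/
theorem clTrialsU : CodeFP unE unE clTrials := by
  have hsq : CodeFP unE unE (fun n => n ^ 2) :=
    ((ulength unitE).comp (unitsMul.comp (replicateUnit.pair replicateUnit))).congr fun n => by simp [sq]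
  exact (unAdd.comp (((unMulConst 4).comp hsq).pair (const unE (4 : ℕ)))).congr fun n => by simp [clTrials]

/-- `clOff` on codes, arguments `(((ℓ, c), (t, i)), l)`. [folklore] -/
theorem clOffC : CodeFP (pairE XE natE) natE (fun q => clOff q.1.1.1 q.1.2.1 q.1.2.2 q.2) := by
  have hℓ : CodeFP (pairE XE natE) natE (fun q => q.1.1.1) := natOfUn.comp (fst _ _).fst'.fst'
  have ht : CodeFP (pairE XE natE) natE (fun q => q.1.2.1) := (fst _ _).snd'.fst'
  have hi : CodeFP (pairE XE natE) natE (fun q => q.1.2.2) := (fst _ _).snd'.snd'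
  have hl : CodeFP (pairE XE natE) natE (fun q => q.2) := snd _ _
  have h := natMul.comp ((natAdd.comp ((natMul.comp ((natAdd.comp ((natMul.comp (ht.pair hℓ)).pair hi)).pair
    (clLevelsC.comp hℓ))).pair hl)).pair (natMul.comp ((const _ (2 : ℕ)).pair (clBlockSizeC.comp hℓ))))
  exact h.congr fun q => by simp [clOff, clSlots]

/-- **`ctrlExpL` on codes.** [cite: AroraBarak2009, §1.3] -/
theorem ctrlExpLC : CodeFP XE natE (fun x => ctrlExpL x.1.1 x.1.2 x.2.1 x.2.2) := by
  have hℓu : CodeFP (pairE XE natE) unE (fun q => q.1.1.1) := (fst _ _).fst'.fst'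
  have hc : CodeFP (pairE XE natE) strE (fun q => q.1.1.2) := (fst _ _).fst'.snd'
  have hl : CodeFP (pairE XE natE) natE (fun q => q.2) := snd _ _
  have hlU : CodeFP (pairE XE natE) unE (fun q => min q.2 (clLevels q.1.1.1)) := unOfNatMin.comp ((clLevelsU.comp hℓu).pair hl)
  have hpow := natPow.comp ((const _ (2 : ℕ)).pair hlU)
  have hwin := winCountC.comp (hc.pair (clOffC.pair (natMul.comp ((const _ (2 : ℕ)).pair (clBlockSizeC.comp (natOfUn.comp hℓu))))))
  have hitem := natMul.comp (hpow.pair hwin)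
  have hmap := (map hitem).comp ((CodeFP.id XE).pair (urange.comp (clLevelsU.comp (fst _ _).fst')))
  refine (natSum.comp hmap).congr fun x => ?_
  simp only [ctrlExpL, id]
  congr 1
  refine List.map_congr_left fun l hl' => ?_
  rw [min_eq_left (List.mem_range.1 hl').le]

/-! ### The trial forms -/

/-- **The trial form of trial `t`** from the slot forms `forms` (padded by the principal form):
the clamped product `∏_i forms_i ^ E_{t,i}(c)`, slot by slot. [cite: Kitaev1995, §4 p. 15; ChildsVandam2010, §5.7] -/
def trialFormL (D : ℤ) (forms : List BinQF) (ℓ : ℕ) (c : List Bool) (t : ℕ) : BinQF :=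
  (List.range (clSlots ℓ)).foldl (fun acc i => compC D acc (powG D (forms.getD i (one D)) (ctrlExpL ℓ c t i))) (one D)

/-- Arguments of the trial form: `((D, forms), ((ℓ, c), t))`. [folklore] -/
abbrev TE : (ℤ × List BinQF) × ((ℕ × List Bool) × ℕ) → List Bool := pairE (pairE intE (rawE formE)) (pairE (pairE unE strE) natE)

/-- **`trialFormL` on codes.** [cite: AroraBarak2009, §1.3 (polynomially bounded loops)] -/
theorem trialFormLC : CodeFP TE formE (fun q => trialFormL q.1.1 q.1.2 q.2.1.1 q.2.1.2 q.2.2) := by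
  -- the step on `(ctx, (i, acc))`
  have hD : CodeFP (pairE TE (pairE natE formE)) intE (fun r => r.1.1.1) := (fst _ _).fst'.fst'
  have hforms : CodeFP (pairE TE (pairE natE formE)) (rawE formE) (fun r => r.1.1.2) := (fst _ _).fst'.snd'
  have hx : CodeFP (pairE TE (pairE natE formE)) XE (fun r => (r.1.2.1, (r.1.2.2, r.2.1))) :=
    (fst _ _).snd'.fst'.pair ((fst _ _).snd'.snd'.pair (snd _ _).fst')
  have hacc : CodeFP (pairE TE (pairE natE formE)) formE (fun r => r.2.2) := (snd _ _).snd'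
  have hslot := (rawGetOr formE).comp (hforms.pair ((snd _ _).fst'.pair (oneC.comp hD)))
  have hpow := powGC.comp (hD.pair (hslot.pair (ctrlExpLC.comp hx)))
  have hstep := compCC.comp (hD.pair (hacc.pair hpow))
  have hinit : CodeFP TE formE (fun q => one q.1.1) := oneC.comp (fst _ _).fst'
  have hsmall : ∀ (q : (ℤ × List BinQF) × ((ℕ × List Bool) × ℕ)) (l : List ℕ),
      Small q.1.1 (l.foldl (fun acc i => compC q.1.1 acc (powG q.1.1 (q.1.2.getD i (one q.1.1)) (ctrlExpL q.2.1.1 q.2.1.2 q.2.2 i))) (one q.1.1)) := by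
    intro q l
    induction l using List.reverseRecOn with
    | nil => exact small_one _
    | append_singleton l i _ => rw [List.foldl_append, List.foldl_cons, List.foldl_nil]; exact small_compC _ _ _
  have h := foldl (σ := (ℤ × List BinQF) × ((ℕ × List Bool) × ℕ)) (α := ℕ) (β := BinQF) (eσ := TE) (eα := natE) (eβ := formE)
    (step := fun q i acc => compC q.1.1 acc (powG q.1.1 (q.1.2.getD i (one q.1.1)) (ctrlExpL q.2.1.1 q.2.1.2 q.2.2 i)))
    (init := fun q => one q.1.1) hstep hinit (C 15 * X + C 29) (fun q l₁ l₂ => by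
      refine (length_formE_le_of_small (hsmall q l₁)).trans ?_
      have hs := size_abs_succ_le q.1.1
      simp only [eval_add, eval_mul, eval_C, eval_X, pairE_apply, length_boolPair]
      nlinarith [Nat.zero_le (rawE natE (l₁ ++ l₂)).length])
  have h' := h.comp ((CodeFP.id TE).pair (urange.comp (snd _ _).fst'.fst'))
  exact h'.congr fun q => rfl

/-- **The typed core of the block**: from `(d, (form codes, (ℓ, c)))` to the `clTrials ℓ` trial forms
of discriminant `−d`. [cite: Kitaev1995, §4 p. 15] -/
def coreOut (p : ℕ × (List (List Bool) × (ℕ × List Bool))) : List BinQF :=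
  (List.range (clTrials p.2.2.1)).map fun t => trialFormL (-(p.1 : ℤ)) (p.2.1.map decodeForm) p.2.2.1 p.2.2.2 t

/-- The code of the arguments of the core. [folklore] -/
abbrev coreE : ℕ × (List (List Bool) × (ℕ × List Bool)) → List Bool := pairE natE (pairE (rawE strE) (pairE unE strE))

/-- **The core on codes.** [cite: AroraBarak2009, §1.3] -/
theorem coreC : CodeFP coreE (rawE formE) coreOut := by
  have hD : CodeFP coreE intE (fun p => -(p.1 : ℤ)) := intNeg.comp (intOfNat.comp (fst _ _))
  have hforms : CodeFP coreE (rawE formE) (fun p => p.2.1.map decodeForm) := (map₀ decodeFormC).comp (snd _ _).fst'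
  have hℓc : CodeFP coreE (pairE unE strE) (fun p => p.2.2) := (snd _ _).snd'
  have hctx := (hD.pair hforms).pair hℓc
  -- items `(ctx, t)`; no expected type here: the unifier must not unfold `trialFormL`
  have hitem := trialFormLC.comp ((fst (pairE (pairE intE (rawE formE)) (pairE unE strE)) natE).fst'.pair
    (((fst (pairE (pairE intE (rawE formE)) (pairE unE strE)) natE).snd').pair (snd (pairE (pairE intE (rawE formE)) (pairE unE strE)) natE)))
  have h := (map hitem).comp (hctx.pair (urange.comp (clTrialsU.comp hℓc.fst')))
  exact h.congr fun p => rfl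

/-! ### The block function: the untyped outer layer -/

section Outer

open Literature.Computability.Complexity.Plumb

/-- The instance length of a data string, in unary. [folklore] -/
theorem lenFC : CodeFP strE unE (fun u => lenOf u.length) := lenOfC.comp strLength

/-- `1^{lenOf |u|}` as a string function. [folklore] -/
def lenF : List Bool → List Bool := Classical.choose lenFC

/-- `lenF ∈ FP`. [folklore] -/
theorem lenF_mem_FP : lenF ∈ FP := (Classical.choose_spec lenFC).1

/-- Value of `lenF`. [folklore] -/
theorem lenF_apply (u : List Bool) : lenF u = unE (lenOf u.length) := (Classical.choose_spec lenFC).2 u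

/-- The instance `w = u ↾ ℓ`. [folklore] -/
def wF : List Bool → List Bool := takeFn ∘ fanoutFn lenF (fun u => u)

/-- The controls `c = u ⇂ ℓ`. [folklore] -/
def cF : List Bool → List Bool := dropFn ∘ fanoutFn lenF (fun u => u)

/-- **The parser**: `u ↦ ⟨fstF w, ⟨sndF w, ⟨1^ℓ, c⟩⟩⟩`. [folklore] -/
def parseF : List Bool → List Bool := fanoutFn (fstF ∘ wF) (fanoutFn (sndF ∘ wF) (fanoutFn lenF cF))

/-- `parseF ∈ FP`. [folklore] -/
theorem parseF_mem_FP : parseF ∈ FP := by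
  have hw : wF ∈ FP := comp_mem_FP takeFn_mem_FP (fanoutFn_mem_FP lenF_mem_FP (PolyTimeComputable.id _))
  have hc : cF ∈ FP := comp_mem_FP dropFn_mem_FP (fanoutFn_mem_FP lenF_mem_FP (PolyTimeComputable.id _))
  exact fanoutFn_mem_FP (comp_mem_FP fstF_mem_FP hw) (fanoutFn_mem_FP (comp_mem_FP sndF_mem_FP hw) (fanoutFn_mem_FP lenF_mem_FP hc))

/-- **The parser on a well-formed data string.** [folklore] -/
theorem parseF_wellFormed (d : ℕ) (L : List (ℕ × ℤ × ℕ)) (c : List Bool) (hc : c.length = clNumControls (encodeClInstance d L).length) :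
    parseF (encodeClInstance d L ++ c) = coreE (d, L.map formCode, (encodeClInstance d L).length, c) := by
  set w := encodeClInstance d L with hw
  have hlen : lenF (w ++ c) = unE w.length := by rw [lenF_apply, List.length_append, hc, lenOf_eq]
  have hwF : wF (w ++ c) = w := by
    rw [wF, Function.comp_apply, fanoutFn_apply, hlen, takeFn_boolPair, length_unE]; exact List.take_left
  have hcF : cF (w ++ c) = c := by
    rw [cF, Function.comp_apply, fanoutFn_apply, hlen, dropFn_boolPair, length_unE]; exact List.drop_left
  rw [parseF, fanoutFn_apply, fanoutFn_apply, fanoutFn_apply, Function.comp_apply, Function.comp_apply, hwF, hcF, hlen, hw,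
    encodeClInstance, fstF_boolPair, sndF_boolPair]
  simp [rawE]

/-- The core as a string function. [folklore] -/
def coreF : List Bool → List Bool := Classical.choose coreC

/-- `coreF ∈ FP`. [folklore] -/
theorem coreF_mem_FP : coreF ∈ FP := (Classical.choose_spec coreC).1

/-- Value of `coreF` on codes. [folklore] -/
theorem coreF_apply (p : ℕ × (List (List Bool) × (ℕ × List Bool))) : coreF (coreE p) = rawE formE (coreOut p) :=
  (Classical.choose_spec coreC).2 p

/-- **The block function** of Kitaev's class-group family: parse, then the trial forms.
[cite: Kitaev1995, §4 p. 15; ChildsVandam2010, §5.7] -/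
def clBlockFn : List Bool → List Bool := coreF ∘ parseF

/-- **`clBlockFn ∈ FP`.** [cite: AroraBarak2009, §1.3 (closure of polynomial time under composition and bounded loops)] -/
theorem clBlockFn_mem_FP : clBlockFn ∈ FP := comp_mem_FP coreF_mem_FP parseF_mem_FP

/-- **The block function on a well-formed data string** `w ++ c` (`w = encodeClInstance d L`,
`|c| = clNumControls |w|`): the coded list of the `clTrials |w|` trial forms `trialFormL`.
[cite: Kitaev1995, §4 p. 15 (the permutations V_j^{2^s} on l registers)] -/
theorem clBlockFn_wellFormed (d : ℕ) (L : List (ℕ × ℤ × ℕ)) (c : List Bool) (hc : c.length = clNumControls (encodeClInstance d L).length) :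
    clBlockFn (encodeClInstance d L ++ c) = rawE formE ((List.range (clTrials (encodeClInstance d L).length)).map
      fun t => trialFormL (-(d : ℤ)) (L.map toForm) (encodeClInstance d L).length c t) := by
  rw [clBlockFn, Function.comp_apply, parseF_wellFormed d L c hc, coreF_apply, coreOut]
  simp only [List.map_map]
  have : decodeForm ∘ formCode = toForm := funext decodeForm_formCode
  rw [this]

end Outer

/-! ### The trial forms of the block are the trial forms of the experiment -/

section Bridge

open Finset

/-- The inverse layout, retyped so that `simp` evaluates it. [folklore] -/
theorem clLayout_symm_apply' {ℓ : ℕ} (p : ClTestLabel ℓ) :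
    (clLayout ℓ).symm p = ((finProdFinEquiv.symm.trans <| Equiv.prodCongr (Equiv.refl _) <|
      finProdFinEquiv.symm.trans <| Equiv.prodCongr (Equiv.refl _) <|
        finProdFinEquiv.symm.trans <| Equiv.prodCongr (Equiv.refl _) <|
          finProdFinEquiv.symm.trans <| Equiv.prodCongr finTwoEquiv (Equiv.refl _)) :
          Fin (clTrials ℓ * (clSlots ℓ * (clLevels ℓ * (2 * clBlockSize ℓ)))) ≃ ClTestLabel ℓ).symm p := rfl

/-- **The position of control `(t, i, l, σ, r)`**: `clOff ℓ t i l + σ B + r`. [folklore] -/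
theorem val_clLayout_symm {ℓ : ℕ} (t : Fin (clTrials ℓ)) (i : Fin (clSlots ℓ)) (l : Fin (clLevels ℓ)) (σ : Bool)
    (r : Fin (clBlockSize ℓ)) :
    (((clLayout ℓ).symm (t, i, l, σ, r) : Fin (clNumControls ℓ)) : ℕ) = clOff ℓ t i l + σ.toNat * clBlockSize ℓ + r := by
  rw [clLayout_symm_apply']
  simp [OFPostCF.val_finTwoEquiv_symm, clOff]
  ring

/-- A list sum over `range` as a `Finset` sum. [folklore] -/
theorem sum_map_range {M : Type*} [AddCommMonoid M] (n : ℕ) (f : ℕ → M) :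
    ((List.range n).map f).sum = ∑ x ∈ Finset.range n, f x := by
  rw [← List.sum_toFinset _ List.nodup_range, List.toFinset_range]

/-- **The exponent of the block is the exponent of the experiment**:
`ctrlExpL ℓ c t i = ctrlExp ℓ c t i` (Kitaev's `∑_{trial j = t, slot j = i} c_j 2^{level j}` regrouped by
levels and read off contiguous windows). [cite: Kitaev1995, §3 Lemma 10, §4 p. 15] -/
theorem ctrlExpL_eq_ctrlExp (ℓ : ℕ) (c : Fin (clNumControls ℓ) → Bool) (t : Fin (clTrials ℓ)) (i : Fin (clSlots ℓ)) :
    ctrlExpL ℓ (List.ofFn c) t i = ctrlExp ℓ c t i := by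
  classical
  rw [ctrlExpL, sum_map_range, sum_range]
  simp only [winCount, OFPostCF.count_take_drop_eq_sum]
  rw [ctrlExp, sum_filter, ← Equiv.sum_comp (clLayout ℓ).symm]
  simp only [clTrialOf, clSlotOf, clLevelOf, Equiv.apply_symm_apply]
  rw [Fintype.sum_prod_type, Finset.sum_eq_single t (fun t' _ ht' => by simp [ht']) (by simp)]
  rw [Fintype.sum_prod_type, Finset.sum_eq_single i (fun i' _ hi' => by simp [hi']) (by simp)]
  simp only [true_and, if_true]
  rw [Fintype.sum_prod_type]
  refine sum_congr rfl fun l _ => ?_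
  rw [Fintype.sum_prod_type, mul_sum,
    ModExpBlock.sum_fin_two_mul (f := fun k => 2 ^ (l : ℕ) * ((List.ofFn c).getD (clOff ℓ t i l + k) false).toNat),
    Fintype.sum_prod_type]
  refine sum_congr rfl fun σ _ => sum_congr rfl fun r _ => ?_
  dsimp only
  have hv := val_clLayout_symm t i l σ r
  have hlt := ((clLayout ℓ).symm (t, i, l, σ, r)).isLt
  rw [hv] at hlt
  rw [show clOff ℓ t i l + (σ.toNat * clBlockSize ℓ + (r : ℕ)) = clOff ℓ t i l + σ.toNat * clBlockSize ℓ + r by ring,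
    List.getD_eq_getElem _ _ (by simp; omega), List.getElem_ofFn]
  have hidx : (⟨clOff ℓ ↑t ↑i ↑l + σ.toNat * clBlockSize ℓ + ↑r, by omega⟩ : Fin (clNumControls ℓ)) = (clLayout ℓ).symm (t, i, l, σ, r) :=
    Fin.ext (by rw [hv])
  rw [hidx]
  cases c ((clLayout ℓ).symm (t, i, l, σ, r)) <;> simp

variable {d : ℕ} {L : List (ℕ × ℤ × ℕ)}

/-- The padded slot list of the block is `slotForm`. [folklore] -/
theorem getD_map_toForm (d : ℕ) (L : List (ℕ × ℤ × ℕ)) (i : ℕ) : (L.map toForm).getD i (one (-(d : ℤ))) = slotForm d L i := by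
  rw [slotForm]
  split_ifs with h
  · rw [List.getD_eq_getElem _ _ (by simpa using h), List.getElem_map]; rfl
  · rw [List.getD_eq_default _ _ (by simpa using h)]

/-- **The trial forms of the block are the trial forms of the experiment** (both are the reduced
representative of `∏_i [slotForm_i]^{E_{t,i}(c)}`, `classOf'_inj`). [cite: Cox2013, §7.B Thm. 7.7; Kitaev1995, §4 p. 15] -/
theorem trialFormL_eq_trialForm (hinst : IsClInstance d L) (ℓ : ℕ) (c : Fin (clNumControls ℓ) → Bool) (t : Fin (clTrials ℓ)) :
    trialFormL (-(d : ℤ)) (L.map toForm) ℓ (List.ofFn c) t = trialForm d L ℓ c t := by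
  obtain ⟨hd, hD4, hL⟩ := hinst
  set Δ := negDiscrOf hd with hΔ
  have hΔD : Δ.D = -(d : ℤ) := rfl
  obtain ⟨t1, t2, t3⟩ := classOf'_trialForm hd hD4 hL ℓ c t
  -- the block side: the fold over the slots
  have key : ∀ (l : List (Fin (clSlots ℓ))) (acc : BinQF), acc.IsPosPrim Δ.D → acc.IsReduced →
      (l.foldl (fun acc (i : Fin (clSlots ℓ)) => compC Δ.D acc (powG Δ.D (slotForm d L i) (ctrlExp ℓ c t i))) acc).IsPosPrim Δ.D ∧
      (l.foldl (fun acc (i : Fin (clSlots ℓ)) => compC Δ.D acc (powG Δ.D (slotForm d L i) (ctrlExp ℓ c t i))) acc).IsReduced ∧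
        classOf' Δ (l.foldl (fun acc (i : Fin (clSlots ℓ)) => compC Δ.D acc (powG Δ.D (slotForm d L i) (ctrlExp ℓ c t i))) acc) =
          classOf' Δ acc * (l.map fun i : Fin (clSlots ℓ) => classOf' Δ (slotForm d L i) ^ ctrlExp ℓ c t i).prod := by
    intro l
    induction l with
    | nil => intro acc h1 h2; exact ⟨h1, h2, by simp⟩
    | cons i l ih =>
      intro acc h1 h2
      obtain ⟨hp, -, hc⟩ := powG_spec Δ hD4 (slotForm_spec hd hD4 hL i).1 (ctrlExp ℓ c t i)
      have hstep : compC Δ.D acc (powG Δ.D (slotForm d L i) (ctrlExp ℓ c t i)) = compose Δ.D acc (powG Δ.D (slotForm d L i) (ctrlExp ℓ c t i)) :=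
        compC_eq_compose Δ.neg h1 hp
      have hs1 : (compC Δ.D acc (powG Δ.D (slotForm d L i) (ctrlExp ℓ c t i))).IsPosPrim Δ.D := by rw [hstep]; exact isPosPrim_compose' Δ h1 hp
      have hs2 : (compC Δ.D acc (powG Δ.D (slotForm d L i) (ctrlExp ℓ c t i))).IsReduced := by rw [hstep]; exact isReduced_compose' Δ h1 hp
      obtain ⟨g1, g2, g3⟩ := ih _ hs1 hs2
      refine ⟨g1, g2, ?_⟩
      rw [List.foldl_cons, g3, List.map_cons, List.prod_cons, ← mul_assoc, hstep, classOf'_compose Δ h1 hp, hc]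
  obtain ⟨o1, o2⟩ := isPosPrim_one Δ.neg hD4
  obtain ⟨g1, g2, g3⟩ := key (List.finRange (clSlots ℓ)) (one Δ.D) o1 o2
  rw [classOf'_one Δ hD4, one_mul, ← Fin.prod_univ_def] at g3
  -- identify the block's fold with `key`'s fold
  have hfold : trialFormL (-(d : ℤ)) (L.map toForm) ℓ (List.ofFn c) t =
      (List.finRange (clSlots ℓ)).foldl (fun acc (i : Fin (clSlots ℓ)) => compC Δ.D acc (powG Δ.D (slotForm d L i) (ctrlExp ℓ c t i))) (one Δ.D) := by
    rw [trialFormL, ← List.map_coe_finRange_eq_range, List.foldl_map, hΔD]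
    congr 1
    funext acc i
    rw [getD_map_toForm, ctrlExpL_eq_ctrlExp]
  rw [hfold]
  exact classOf'_inj Δ g1 t1 g2 t2 (g3.trans t3.symm)

end Bridge

end ClBlockFP

end Literature.Computability.Cryptography.Hallgren2005

end
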